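import Literature.Probability.LatticeModels.RCContourWF
import Literature.Probability.LatticeModels.RCClassCount
import HarnessLib

/-!
# Random-cluster contours, V: energies, cluster counts, contour weights; the energy decomposition

Topic `Literature/Probability/LatticeModels`. The weight of a configuration of the random-cluster model
in the volume `U` with boundary condition `σ` is `t^{E} q^{κ}` where (half-charging each open edge to
its two endpoints) `E = Σ_{x ∈ U} o(x)`, `o(x)` the number of open edges at `x`, and `κ` is the number
of open clusters of `U` (with the boundary layer `U ∖ inner1 U` wired when `σ = ord`, minus one); here
`t² = p/(1-p)`. We define these (`oDeg`, `energy`, `ROpen`, `kappa`, `Zrc`), their intrinsic versions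
for a contour (`Contour.oDeg`, `Contour.energy`, the glued site set `Contour.Ugl` with its wired open
relation `Contour.Rsharp`, `Contour.ccl`, `Contour.cwt`), and prove the **agreement lemmas**: on a site
of an interior component `A` of an external contour the configuration looks like the configuration
`ω ∩ freeEdges A` of the volume `A` with boundary condition `lab A` (FV: "ω_i = η^{#'} on the collar of
int_{#'} γ'"), and on the exterior of all contours like the pure phase `σ`. Consequence: the **energy
decomposition** `E_V(ω) = 2d [σ = ord] |V^ext| + Σ_{γ'} e(γ') + Σ_{γ',A} E_A(ω_A)` (the `t`-part of
FV (7.28) / Grimmett (7.65)).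

Everything is proved; no named facts.

## References

* S. Friedli, Y. Velenik, *Statistical Mechanics of Lattice Systems*, CUP 2017, §7.3.1, eq. (7.28)
  and the identity `ω_i = η^{#'}_i` on thinned interiors. [FriedliVelenik2017]
* G. Grimmett, *The Random-Cluster Model*, Springer 2006, §7.5, eqs. (7.63)–(7.66). [Grimmett2006]
-/

noncomputable section

open Finset Relation

namespace Literature.Probability.LatticeModels

namespace RCC

open ContourSetup ClassCount

variable {d : ℕ}

/-! ### Energies and cluster counts of a configuration -/

/-- The number of open edges at `x` (half-charging of the edge energy). [cite: Grimmett2006, §7.5, eq. (7.63)] -/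
def oDeg (σ : Phase) (F ω : Finset (Sym2 (Site d))) (x : Site d) : ℕ := #((nbrs x).filter fun y => EOpen σ F ω s(x, y))

/-- The energy of a finite set of sites: the total number of open half-edges at its sites. [cite: Grimmett2006, §7.5] -/
def energy (σ : Phase) (F ω : Finset (Sym2 (Site d))) (U : Finset (Site d)) : ℕ := ∑ x ∈ U, oDeg σ F ω x

/-- The open-adjacency relation of a configuration. [cite: Grimmett2006, §1.2 (open paths)] -/
def ROpen (σ : Phase) (F ω : Finset (Sym2 (Site d))) (a b : Site d) : Prop := (zdGraph d).Adj a b ∧ EOpen σ F ω s(a, b)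

/-- `ROpen` is symmetric. [folklore] -/
theorem rOpen_symm (σ : Phase) (F ω : Finset (Sym2 (Site d))) : ∀ a b, ROpen σ F ω a b → ROpen σ F ω b a :=
  fun _ _ h => ⟨h.1.symm, by rw [Sym2.eq_swap]; exact h.2⟩

/-- **The cluster functional** of a configuration of the volume `U` with boundary condition `σ`: for
`σ = ord` the number of open clusters of `U` with the boundary layer `U ∖ inner1 U` wired, minus one;
for `σ = dis` the number of open clusters of `U`. [cite: Grimmett2006, §4.2 (k(ω) with wired/free b.c.) and §7.5] -/
def kappa (σ : Phase) (U : Finset (Site d)) (F ω : Finset (Sym2 (Site d))) : ℕ :=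
  match σ with
  | Phase.ord => ccount (wire (ROpen Phase.ord F ω) (U \ inner1 U)) U - 1
  | Phase.dis => ccount (ROpen Phase.dis F ω) U

/-- **The random-cluster partition function of the volume `U` with boundary condition `σ`**, in the
variables `t = (p/(1-p))^{1/2}` and `q`: `Z^σ(U) = Σ_{ω ⊆ freeEdges U} t^{E_U(ω)} q^{κ^σ_U(ω)}`.
[cite: Grimmett2006, §7.5, eq. (7.65)–(7.66); FriedliVelenik2017, §7.3, eq. (7.27)] -/
def Zrc (t q : ℝ) (σ : Phase) (U : Finset (Site d)) : ℝ :=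
  ∑ ω ∈ (freeEdges U).powerset, t ^ energy σ (freeEdges U) ω U * q ^ kappa σ U (freeEdges U) ω

/-! ### Intrinsic quantities of a contour -/

namespace Contour

/-- The intrinsic number of open edges at `x`. [cite: Grimmett2006, §7.5] -/
def oDeg (γ : Contour d) (x : Site d) : ℕ := by classical exact #((nbrs x).filter fun y => γ.IsOpen s(x, y))

/-- **The energy of a contour**: the open half-edges at the sites of its support. [cite: Grimmett2006, §7.5; FriedliVelenik2017, eq. (7.28) (‖γ‖)] -/
def energy (γ : Contour d) : ℕ := ∑ x ∈ γ.supp, γ.oDeg x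

/-- The intrinsic open-adjacency relation. [folklore] -/
def ROpen (γ : Contour d) (a b : Site d) : Prop := (zdGraph d).Adj a b ∧ γ.IsOpen s(a, b)

/-- The exterior block `O_γ = ∂^ex(hull γ̄)` if the type is `ord`, empty otherwise. [cite: Grimmett2006, §7.5 (the wired exterior vertex)] -/
def Opart (γ : Contour d) : Finset (Site d) := if γ.type = Phase.ord then exBoundary (starHullFinset γ.supp) else ∅

/-- The interior components. [cite: FriedliVelenik2017, §7.2.6] -/
def intComps (γ : Contour d) : Finset (Finset (Site d)) := (starInt γ.supp).image (starIntComp γ.supp)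

/-- The `ord`-labelled interior components. [cite: FriedliVelenik2017, §7.2.6] -/
def ordInts (γ : Contour d) : Finset (Finset (Site d)) := γ.intComps.filter fun A => γ.lab A = Phase.ord

/-- **The glued site set of a contour**: support, exterior block, and the interior boundaries of the
`ord`-labelled interior components. [cite: Grimmett2006, §7.5 (the graph obtained by contracting the exterior and the interiors)] -/
def Ugl (γ : Contour d) : Finset (Site d) := γ.supp ∪ γ.Opart ∪ γ.ordInts.biUnion inBoundary

/-- **The wired intrinsic open relation**: intrinsic open adjacency, plus all steps inside the exterior
block and inside each `ord` interior boundary. [cite: Grimmett2006, §7.5] -/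
def Rsharp (γ : Contour d) (a b : Site d) : Prop :=
  γ.ROpen a b ∨ (a ∈ γ.Opart ∧ b ∈ γ.Opart) ∨ ∃ A ∈ γ.ordInts, a ∈ inBoundary A ∧ b ∈ inBoundary A

/-- The number of classes of the glued contour graph. [cite: Grimmett2006, §7.5] -/
def ccl (γ : Contour d) : ℕ := ccount γ.Rsharp γ.Ugl

/-- **The cluster weight exponent of a contour**: classes of the glued graph, minus one for the exterior
class when the type is `ord`. [cite: Grimmett2006, §7.5, eq. (7.66)] -/
def cwt (γ : Contour d) : ℕ := γ.ccl - if γ.type = Phase.ord then 1 else 0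

/-- `Rsharp` is symmetric. [folklore] -/
theorem rsharp_symm (γ : Contour d) : ∀ a b, γ.Rsharp a b → γ.Rsharp b a := by
  rintro a b (h | h | ⟨A, hA, h⟩)
  · exact Or.inl ⟨h.1.symm, by rw [Sym2.eq_swap]; exact h.2⟩
  · exact Or.inr (Or.inl ⟨h.2, h.1⟩)
  · exact Or.inr (Or.inr ⟨A, hA, h.2, h.1⟩)

end Contour

/-! ### Basic facts -/

/-- `nbrs x` is the neighbour finset of `x`; in particular `|nbrs x| = 2d`. [cite: FriedliVelenik2017, §3.1] -/
theorem card_nbrs (x : Site d) : #(nbrs x) = 2 * d := by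
  rw [← card_neighborFinset_zdGraph_holds x]
  congr 1; ext y; rw [mem_nbrs, SimpleGraph.mem_neighborFinset]

/-- The open degree is at most `2d`. [folklore] -/
theorem oDeg_le (σ : Phase) (F ω : Finset (Sym2 (Site d))) (x : Site d) : oDeg σ F ω x ≤ 2 * d :=
  (card_le_card (filter_subset _ _)).trans (card_nbrs x).le

/-- The open degree of an `ord`-good site is `2d`. [folklore] -/
theorem oDeg_of_ordGood {σ : Phase} {F ω : Finset (Sym2 (Site d))} {x : Site d} (hx : OrdGood σ F ω x) : oDeg σ F ω x = 2 * d := by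
  rw [oDeg, ← card_nbrs x]
  congr 1
  exact filter_true_of_mem fun y hy => hx _ (mem_ballEdges_iff.2 ⟨(SimpleGraph.mem_edgeSet _).2 (mem_nbrs.1 hy),
    mem_coBall_of_mem ((SimpleGraph.mem_edgeSet _).2 (mem_nbrs.1 hy)) (Sym2.mem_mk_left _ _)⟩)

/-- The open degree of a `dis`-good site is `0`. [folklore] -/
theorem oDeg_of_disGood {σ : Phase} {F ω : Finset (Sym2 (Site d))} {x : Site d} (hx : DisGood σ F ω x) : oDeg σ F ω x = 0 := by
  rw [oDeg, card_eq_zero, filter_eq_empty_iff]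
  exact fun y hy => hx _ (mem_ballEdges_iff.2 ⟨(SimpleGraph.mem_edgeSet _).2 (mem_nbrs.1 hy),
    mem_coBall_of_mem ((SimpleGraph.mem_edgeSet _).2 (mem_nbrs.1 hy)) (Sym2.mem_mk_left _ _)⟩)

/-- The edge to a neighbour lies in the ball. [folklore] -/
theorem mk_mem_ballEdges_of_mem_nbrs {x y : Site d} (hy : y ∈ nbrs x) : s(x, y) ∈ ballEdges x :=
  mem_ballEdges_iff.2 ⟨(SimpleGraph.mem_edgeSet _).2 (mem_nbrs.1 hy),
    mem_coBall_of_mem ((SimpleGraph.mem_edgeSet _).2 (mem_nbrs.1 hy)) (Sym2.mem_mk_left _ _)⟩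

/-- `freeEdges` is monotone in the volume. [folklore] -/
theorem freeEdges_mono {A V : Finset (Site d)} (h : A ⊆ V) : freeEdges A ⊆ freeEdges V := fun e he => by
  rw [mem_freeEdges] at he ⊢
  exact ⟨he.1, he.2.trans fun i hi => mem_core.2 ((mem_core.1 hi).trans h)⟩

/-- `∂^in_★ A = A ∖ inner1 A`. [folklore] -/
theorem inBoundary_eq_sdiff_inner1 (A : Finset (Site d)) : inBoundary A = A \ inner1 A := by
  ext x
  rw [mem_inBoundary, mem_sdiff, mem_inner1]
  constructor
  · rintro ⟨hx, y, hyA, hxy⟩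
    exact ⟨hx, fun h => hyA (h (adj_iff_mem_starBall.1 hxy).1)⟩
  · rintro ⟨hx, h⟩
    obtain ⟨y, hy, hyA⟩ := not_subset.1 h
    exact ⟨hx, y, hyA, adj_iff_mem_starBall.2 ⟨hy, fun h' => hyA (h' ▸ hx)⟩⟩

/-! ### Agreement lemmas -/

section Agreement

variable {σ : Phase} {V : Finset (Site d)} {ω : Finset (Sym2 (Site d))} (hd : 2 ≤ d) (hω : ω ⊆ freeEdges V)
  (hV : StarConn (V : Set (Site d))ᶜ)
include hd hω

/-- **On the exterior of all contours the configuration is the pure phase.** [cite: FriedliVelenik2017, §7.3, Lemma 7.23] -/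
theorem eOpen_iff_of_mem_exteriorAll {x : Site d} (hx : x ∈ exteriorAll σ (freeEdges V) ω) {y : Site d} (hy : y ∈ nbrs x) :
    EOpen σ (freeEdges V) ω s(x, y) ↔ σ = Phase.ord := by
  have hd1 : 1 ≤ d := by omega
  have hg := good_of_mem_exteriorAll hd hω hx
  cases σ with
  | ord => exact ⟨fun _ => rfl, fun _ => hg _ (mk_mem_ballEdges_of_mem_nbrs hy)⟩
  | dis => exact ⟨fun h => absurd h (hg _ (mk_mem_ballEdges_of_mem_nbrs hy)), fun h => absurd h (by decide)⟩

/-- The open degree on the exterior of all contours. [cite: FriedliVelenik2017, §7.3, Lemma 7.23] -/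
theorem oDeg_of_mem_exteriorAll {x : Site d} (hx : x ∈ exteriorAll σ (freeEdges V) ω) :
    oDeg σ (freeEdges V) ω x = if σ = Phase.ord then 2 * d else 0 := by
  have hg := good_of_mem_exteriorAll hd hω hx
  cases σ with
  | ord => exact oDeg_of_ordGood hg
  | dis => exact oDeg_of_disGood hg

variable {γ : (rcSetup d).Γ} (hγ : γ ∈ extContours σ hω)
include hγ

omit hd hω hγ in
/-- The value of a ball edge of a non-bad site is its type. [folklore] -/
theorem eOpen_iff_ordGood_of_not_bad {σ' : Phase} {F ω' : Finset (Sym2 (Site d))} {v : Site d} (hv : ¬ Bad σ' F ω' v)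
    {e : Sym2 (Site d)} (he : e ∈ ballEdges v) : EOpen σ' F ω' e ↔ OrdGood σ' F ω' v := by
  constructor
  · intro ho
    by_contra hno
    have hdis : DisGood σ' F ω' v := by by_contra hnd; exact hv ⟨hno, hnd⟩
    exact hdis e he ho
  · intro hg; exact hg e he

/-- **The label of an interior component is the type of each of its interior-boundary sites.**
[cite: FriedliVelenik2017, §7.2.6, Lemma 7.19] -/
theorem lab_eq_ord_iff_of_mem_inBoundary {A : Finset (Site d)} (hA : A ∈ (rcSetup d).ints γ) {y : Site d} (hy : y ∈ inBoundary A) :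
    (rcSetup d).lab γ A = Phase.ord ↔ OrdGood σ (freeEdges V) ω y := by
  obtain ⟨hs, -⟩ := supp_mem_of_mem_extContours hγ
  obtain ⟨T, -, hγT⟩ := mem_extContours.1 hγ
  have hTs : T.1 = γ.1.supp := by rw [hγT]; rfl
  obtain ⟨u, hu, rfl⟩ := mem_ints.1 hA
  change γ.1.lab (starIntComp γ.1.supp u) = Phase.ord ↔ _
  change u ∈ starInt γ.1.supp at hu
  change y ∈ inBoundary (starIntComp γ.1.supp u) at hy
  have hγT' := hγT
  rw [hTs] at hγT'
  rw [hγT']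
  simp only [contourAt_supp]
  exact lab_contourAt_eq_ord_iff hω hs hd hu hy

/-- Interior-boundary sites of an interior component are good with a good ball, of the type of the
label. [cite: FriedliVelenik2017, §7.2.6, Lemma 7.19] -/
theorem not_bad_of_mem_starBall_inBoundary {A : Finset (Site d)} (hA : A ∈ (rcSetup d).ints γ) {y : Site d}
    (hy : y ∈ inBoundary A) {z : Site d} (hz : z ∈ starBall y) : ¬ Bad σ (freeEdges V) ω z := by
  obtain ⟨hs, -⟩ := supp_mem_of_mem_extContours hγ
  have hyb : y ∈ exBoundary γ.1.supp := by
    obtain ⟨hyA, w, hwA, hyw⟩ := mem_inBoundary.1 hy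
    have hwS : w ∈ γ.1.supp := by
      by_contra hwS
      exact hwA (mem_of_adj_of_mem_ints hd (S := rcSetup d) hA hyA hwS hyw)
    have hyS : y ∉ γ.1.supp := Finset.disjoint_left.1 (disjoint_supp_of_mem_ints hd (S := rcSetup d) hA) hyA
    exact mem_exBoundary.2 ⟨hyS, w, hwS, hyw.symm⟩
  exact not_bad_near_exBoundary hω hs hyb hz

include hV in
/-- Interior components of external contours lie in the volume. [cite: FriedliVelenik2017, §7.3] -/
theorem subset_of_mem_ints_ext {A : Finset (Site d)} (hA : A ∈ (rcSetup d).ints γ) : A ⊆ V :=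
  (subset_intr_of_mem_ints (S := rcSetup d) hA).trans ((intr_subset_hull (S := rcSetup d) γ).trans
    (hull_subset_of_inVol hd hV (inVol_of_mem_extContours hγ)))

omit hω hγ in
/-- A site of an interior component `★`-adjacent to a site off the component is an interior-boundary
site, and that site lies in the support. [folklore] -/
theorem mem_inBoundary_of_adj {A : Finset (Site d)} (hA : A ∈ (rcSetup d).ints γ) {x i : Site d} (hx : x ∈ A) (hi : i ∉ A)
    (hxi : supDist x i ≤ 1) : x ∈ inBoundary A ∧ i ∈ γ.1.supp := by
  have hne : x ≠ i := fun h => hi (h ▸ hx)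
  have hadj : (zdStar d).Adj x i := zdStar_adj.2 ⟨hne, hxi⟩
  have hiS : i ∈ γ.1.supp := by
    by_contra hiS
    exact hi (mem_of_adj_of_mem_ints hd (S := rcSetup d) hA hx hiS hadj)
  exact ⟨mem_inBoundary.2 ⟨hx, i, hi, hadj⟩, hiS⟩

include hV in
/-- **Agreement on interior components** (FV: `ω = η^{#'}` on the collar of a thinned interior): for a
site `x` of an interior component `A` of an external contour and a neighbour `y`, the edge `xy` is open
in `ω` iff it is open in the configuration `ω ∩ freeEdges A` of the volume `A` with boundary condition
`lab A`. [cite: FriedliVelenik2017, §7.3.1 (proof of (7.28)); Grimmett2006, §7.5] -/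
theorem eOpen_iff_eOpen_inter {A : Finset (Site d)} (hA : A ∈ (rcSetup d).ints γ) {x : Site d} (hx : x ∈ A) {y : Site d}
    (hy : y ∈ nbrs x) :
    EOpen σ (freeEdges V) ω s(x, y) ↔ EOpen ((rcSetup d).lab γ A) (freeEdges A) (ω ∩ freeEdges A) s(x, y) := by
  have hd1 : 1 ≤ d := by omega
  have hωA : ω ∩ freeEdges A ⊆ freeEdges A := inter_subset_right
  have heE : s(x, y) ∈ (zdGraph d).edgeSet := (SimpleGraph.mem_edgeSet _).2 (mem_nbrs.1 hy)
  by_cases hfree : s(x, y) ∈ freeEdges A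
  · rw [eOpen_iff_of_mem (freeEdges_mono (subset_of_mem_ints_ext hd hω hV hγ hA) hfree), eOpen_iff_of_mem hfree, mem_inter]
    exact ⟨fun h => ⟨h, hfree⟩, fun h => h.1⟩
  · rw [eOpen_iff_of_not_mem hωA hfree]
    -- a site `i` of the co-ball of the edge outside the core of `A`
    obtain ⟨i, hi, hic⟩ : ∃ i ∈ coBall s(x, y), i ∉ core A := by
      by_contra hall
      push Not at hall
      exact hfree (mem_freeEdges.2 ⟨heE, hall⟩)
    have hxi : x ∈ starBall i := mem_coBall_iff.1 hi x (Sym2.mem_mk_left x y)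
    have hxi' : supDist x i ≤ 1 := by rw [supDist_comm]; exact mem_starBall.1 hxi
    have hei : s(x, y) ∈ ballEdges i := mem_ballEdges_iff.2 ⟨heE, hi⟩
    have hex : s(x, y) ∈ ballEdges x := mk_mem_ballEdges_of_mem_nbrs hy
    by_cases hiA : i ∈ A
    · -- `i ∈ A ∖ core A`: a point `w ∉ A` at distance `≤ 2`, midpoint `z`
      obtain ⟨w, hw, hwA⟩ : ∃ w ∈ starBall2 i, w ∉ A := by
        by_contra hall; push Not at hall; exact hic (mem_core.2 hall)
      obtain ⟨z, hiz, hzw⟩ := exists_midpoint (mem_starBall2.1 hw)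
      by_cases hzA : z ∈ A
      · -- `z ∈ ∂^in A` with a good ball containing `i`
        obtain ⟨hzb, -⟩ := mem_inBoundary_of_adj hd hA hzA hwA hzw
        have hinb : ¬ Bad σ (freeEdges V) ω i :=
          not_bad_of_mem_starBall_inBoundary hd hω hγ hA hzb (mem_starBall_comm.1 (mem_starBall.2 hiz))
        have hznb : ¬ Bad σ (freeEdges V) ω z := not_bad_of_mem_starBall_inBoundary hd hω hγ hA hzb (mem_starBall_self z)
        rw [eOpen_iff_ordGood_of_not_bad hinb hei, lab_eq_ord_iff_of_mem_inBoundary hd hω hγ hA hzb]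
        exact ⟨fun h => ordGood_of_supDist_le_one hd1 hiz h hznb,
          fun h => ordGood_of_supDist_le_one hd1 (by rwa [supDist_comm]) h hinb⟩
      · -- `z ∉ A` adjacent to `i ∈ A`: `i ∈ ∂^in A`
        obtain ⟨hib, -⟩ := mem_inBoundary_of_adj hd hA hiA hzA hiz
        have hinb : ¬ Bad σ (freeEdges V) ω i := not_bad_of_mem_starBall_inBoundary hd hω hγ hA hib (mem_starBall_self i)
        rw [eOpen_iff_ordGood_of_not_bad hinb hei, lab_eq_ord_iff_of_mem_inBoundary hd hω hγ hA hib]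
    · -- `i ∉ A` adjacent to `x ∈ A`: `x ∈ ∂^in A`
      obtain ⟨hxb, -⟩ := mem_inBoundary_of_adj hd hA hx hiA hxi'
      have hxnb : ¬ Bad σ (freeEdges V) ω x := not_bad_of_mem_starBall_inBoundary hd hω hγ hA hxb (mem_starBall_self x)
      rw [eOpen_iff_ordGood_of_not_bad hxnb hex, lab_eq_ord_iff_of_mem_inBoundary hd hω hγ hA hxb]

include hV in
/-- **The open degree on an interior component agrees with that of the restricted configuration.**
[cite: FriedliVelenik2017, §7.3.1, eq. (7.28)] -/
theorem oDeg_eq_of_mem_ints {A : Finset (Site d)} (hA : A ∈ (rcSetup d).ints γ) {x : Site d} (hx : x ∈ A) :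
    oDeg σ (freeEdges V) ω x = oDeg ((rcSetup d).lab γ A) (freeEdges A) (ω ∩ freeEdges A) x := by
  rw [oDeg, oDeg]
  congr 1
  exact filter_congr fun y hy => eOpen_iff_eOpen_inter hd hω hV hγ hA hx hy

/-- **The open degree on the support agrees with the intrinsic one.** [cite: FriedliVelenik2017, §7.3.1, eq. (7.28)] -/
theorem oDeg_eq_of_mem_supp {x : Site d} (hx : x ∈ γ.1.supp) : oDeg σ (freeEdges V) ω x = γ.1.oDeg x := by
  classical
  obtain ⟨hs, -⟩ := supp_mem_of_mem_extContours hγ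
  obtain ⟨T, -, hγT⟩ := mem_extContours.1 hγ
  have hTs : T.1 = γ.1.supp := by rw [hγT]; rfl
  rw [oDeg, Contour.oDeg]
  congr 1
  refine filter_congr fun y hy => ?_
  rw [hγT]
  exact (isOpen_iff_eOpen_of_mem_supp hω (hTs ▸ hs) hd (hTs ▸ hx) (mk_mem_ballEdges_of_mem_nbrs hy)).symm

end Agreement

/-! ### The exterior part of the volume and the energy decomposition -/

section Energy

variable {σ : Phase} {V : Finset (Site d)} {ω : Finset (Sym2 (Site d))} (hd : 2 ≤ d) (hω : ω ⊆ freeEdges V)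
  (hV : StarConn (V : Set (Site d))ᶜ)

/-- **The exterior part of the volume**: the sites of `V` outside the hulls of the external contours.
[cite: FriedliVelenik2017, §7.3 (Λ^ext)] -/
def Vext (σ : Phase) (V : Finset (Site d)) {ω : Finset (Sym2 (Site d))} (hω : ω ⊆ freeEdges V) : Finset (Site d) :=
  V.filter fun x => ∀ γ ∈ extContours σ hω, x ∉ (rcSetup d).hull γ

include hd in
/-- Membership in `Vext`: in `V` and in the exterior of all contours. [cite: FriedliVelenik2017, §7.3] -/
theorem mem_Vext_iff {x : Site d} : x ∈ Vext σ V hω ↔ x ∈ V ∧ x ∈ exteriorAll σ (freeEdges V) ω := by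
  classical
  rw [Vext, mem_filter, exteriorAll_eq_commonExt hd]
  refine and_congr_right fun _ => ⟨fun h T hT => ?_, fun h γ hγ hx => ?_⟩
  · have hmem : wfContourAt hω T.1 (mem_rawSupports.1 (maxP_subset (S := rawSetup d) _ hT)) ∈ extContours σ hω :=
      mem_extContours.2 ⟨T, hT, rfl⟩
    have := h _ hmem
    change x ∉ starHullFinset T.1 at this
    by_contra hxe
    exact this ((mem_starHullFinset hd).2 hxe)
  · obtain ⟨T, hT, hγT⟩ := mem_extContours.1 hγ
    have hTs : T.1 = γ.1.supp := by rw [hγT]; rfl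
    have := h T hT
    rw [hTs] at this
    exact (mem_starHullFinset hd).1 hx this

include hd hV in
/-- **The volume is the disjoint union of its exterior part and the hulls of the external contours.**
[cite: FriedliVelenik2017, §7.3, eq. (7.28)] -/
theorem eq_Vext_union_biUnion_hull : V = Vext σ V hω ∪ (extContours σ hω).biUnion (rcSetup d).hull := by
  ext x
  rw [mem_union, Vext, mem_filter, mem_biUnion]
  constructor
  · intro hx
    by_cases h : ∃ γ ∈ extContours σ hω, x ∈ (rcSetup d).hull γ
    · exact Or.inr h
    · push Not at h; exact Or.inl ⟨hx, h⟩
  · rintro (⟨hx, -⟩ | ⟨γ, hγ, hx⟩)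
    · exact hx
    · exact hull_subset_of_inVol hd hV (inVol_of_mem_extContours hγ) hx

/-- `Vext` is disjoint from the hulls. [folklore] -/
theorem disjoint_Vext_biUnion_hull : Disjoint (Vext σ V hω) ((extContours σ hω).biUnion (rcSetup d).hull) := by
  rw [Finset.disjoint_left]
  intro x hx hx'
  obtain ⟨γ, hγ, hxγ⟩ := mem_biUnion.1 hx'
  exact (mem_filter.1 hx).2 γ hγ hxγ

include hd in
/-- The hull of a contour is the disjoint union of its support and its interior components. [cite: FriedliVelenik2017, §7.2.6] -/
theorem hull_eq_supp_union_biUnion_ints (γ : (rcSetup d).Γ) :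
    (rcSetup d).hull γ = (rcSetup d).supp γ ∪ ((rcSetup d).ints γ).biUnion id := by
  ext x
  rw [mem_hull_iff hd (S := rcSetup d), mem_union, mem_biUnion, mem_intr_iff_exists_ints hd (S := rcSetup d)]
  simp only [id_eq]

include hd hω hV in
/-- **The energy decomposition** (`t`-part of FV (7.28) / Grimmett (7.65)):
`E_V(ω) = 2d[σ = ord] |V^ext| + Σ_{γ external} e(γ) + Σ_{γ} Σ_{A ∈ ints γ} E_A(ω ∩ freeEdges A)`.
[cite: FriedliVelenik2017, §7.3.1, eq. (7.28); Grimmett2006, §7.5, eq. (7.65)] -/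
theorem energy_decomposition :
    energy σ (freeEdges V) ω V = (if σ = Phase.ord then 2 * d else 0) * #(Vext σ V hω) +
      ∑ γ ∈ extContours σ hω, (γ.1.energy + ∑ A ∈ (rcSetup d).ints γ,
        energy ((rcSetup d).lab γ A) (freeEdges A) (ω ∩ freeEdges A) A) := by
  have hdisj := pairwise_disjoint_hull_extContours hd hω (σ := σ)
  rw [energy, eq_Vext_union_biUnion_hull hd hω hV (σ := σ) |> fun h => (sum_congr h fun _ _ => rfl :
      ∑ x ∈ V, oDeg σ (freeEdges V) ω x = ∑ x ∈ Vext σ V hω ∪ (extContours σ hω).biUnion (rcSetup d).hull, oDeg σ (freeEdges V) ω x),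
    sum_union (disjoint_Vext_biUnion_hull hω), sum_biUnion (fun γ hγ γ' hγ' hne => hdisj hγ hγ' hne)]
  congr 1
  · rw [sum_congr rfl fun x hx => oDeg_of_mem_exteriorAll hd hω ((mem_Vext_iff hd hω).1 hx).2, sum_const, smul_eq_mul, mul_comm]
  · refine sum_congr rfl fun γ hγ => ?_
    rw [hull_eq_supp_union_biUnion_ints hd γ, sum_union, sum_biUnion]
    · congr 1
      · exact sum_congr rfl fun x hx => oDeg_eq_of_mem_supp hd hω hγ hx
      · refine sum_congr rfl fun A hA => sum_congr rfl fun x hx => ?_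
        exact oDeg_eq_of_mem_ints hd hω hV hγ hA hx
    · intro A hA B hB hne
      exact disjoint_of_mem_ints hd (S := rcSetup d) hA hB hne
    · rw [Finset.disjoint_left]
      intro x hx hx'
      obtain ⟨A, hA, hxA⟩ := mem_biUnion.1 hx'
      have hxA' : x ∈ A := hxA
      exact Finset.disjoint_left.1 (disjoint_supp_of_mem_ints hd (S := rcSetup d) hA) hxA' hx

end Energy



end RCC

end Literature.Probability.LatticeModels

end
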